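import Literature.NumberTheory.Transcendental.AnalytificationExistenceProofs
import Literature.NumberTheory.Transcendental.AnalytificationFunctorialityProofs
import Literature.AlgebraicGeometry.Motives.AlgPointsProductProofs
import Literature.AlgebraicGeometry.Motives.SegreEmbedding
import Literature.Analysis.Complex.InjectiveHolomorphic
import HarnessLib

/-!
# The analytification of a product is the product of the analytifications (proof file)

Family `hodge`, layer `Literature/NumberTheory/Transcendental`, next to `Analytification.lean`
(whose predicate `IsAnalytification E X d φ` — `φ : M → X(ℂ)` exhibits the complex charted space
`M` as `X^an` — it uses). Serre, GAGA §2 n°5, p. 9, lists among the elementary properties of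
`X ↦ X^h` («Les propriétés suivantes résultent immédiatement de la définition de `X^h`»): «Si `X`
et `Y` sont deux variétés algébriques, on a `(X × Y)^h = X^h × Y^h`» (held text
`paper:doi-10-5802-aif-59`, p0010 L16–18); SGA 1, Exp. XII, §1: the functor `X ↦ X^an` commutes
with fibre products.
This file PROVES that property on the tree's vocabulary, with no new definition and no named fact:

* `mdifferentiable_symm_of_mdifferentiable` — the tool: a holomorphic HOMEOMORPHISM between
  complex manifolds of the same (finite) dimension is a biholomorphism (its inverse is holomorphic).
  This is the Clements–Osgood theorem (an injective holomorphic map between equidimensional complex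
  manifolds has invertible differential; tree
  `Literature.Analysis.Complex.SCV.bijective_fderiv_of_injOn`, Fritzsche–Grauert Ch. I §8
  Thm. 8.5) followed by the easy half of the inverse function theorem
  (Mathlib `HasFDerivAt.of_local_left_inverse`).
* `exists_homeomorph_prod` — for analytifications `φ : M → X(ℂ)`, `ψ : M' → Y(ℂ)` (holomorphic
  atlases; `X`, `Y` smooth over `k ⊆ ℂ`, locally of finite type) and ANY analytification
  `χ : N → (X ×ₖ Y)(ℂ)` with a holomorphic atlas, there is a biholomorphism `Θ : M × M' ≃ₜ N`
  (holomorphic in both directions for the product complex structure `𝓘(ℂ, E).prod 𝓘(ℂ, E')`) with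
  `χ ∘ Θ = (φ × ψ)` (pairs of points read through `AlgPoints.prodEquiv`). The map
  `Θ⁻¹ = (φ⁻¹ ∘ pr₁(ℂ) ∘ χ, ψ⁻¹ ∘ pr₂(ℂ) ∘ χ)` is holomorphic by functoriality of the
  analytification (`IsAnalytification.mdifferentiable_comp_map_holds`) and bijective
  (`AlgPoints.isHomeomorph_prodEquiv_holds`); the tool gives holomorphy of `Θ`.
* `IsAnalytification.prod` — consequently `p ↦ (φ p.1, ψ p.2) : M × M' → (X ×ₖ Y)(ℂ)` IS an
  analytification of `X ×ₖ Y` for the product charted space (model `E × E'`), for `X`, `Y` smooth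
  separated of finite type (so that some `χ` exists, `exists_isAnalytification_holds`).
  (The product charted space is Mathlib's `prodChartedSpace`, modelled on `ModelProd E E' = E × E'`;
  to read the result with the self model note `𝓘(ℂ, E × E') = 𝓘(ℂ, E).prod 𝓘(ℂ, E')`,
  Mathlib `modelWithCornersSelf_prod`, so `IsManifold 𝓘(ℂ, E × E') ω (M × M')` is
  `by rw [modelWithCornersSelf_prod]; exact inferInstanceAs (IsManifold (𝓘(ℂ, E).prod 𝓘(ℂ, E')) ω _)`.)
* `mdifferentiable_of_comp_prod`, `mdifferentiable_prodMk_of_comp` — functoriality out of and into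
  products: a morphism `g : X ×ₖ Y ⟶ Z` (e.g. the group law of an abelian variety) induces a
  HOLOMORPHIC map `M × M' → M''` for the Mathlib product structure, and a morphism `g : Z ⟶ X ×ₖ Y`
  a holomorphic map `M'' → M × M'`.

## References

* J.-P. Serre, *Géométrie algébrique et géométrie analytique*, Ann. Inst. Fourier **6** (1956),
  §2 n°5 p. 9 (propriétés de `X^h`: produits, fonctorialité). [SerreGAGA1956]
* A. Grothendieck, M. Raynaud, *SGA 1*, Exp. XII, §1. [SGA1]
* K. Fritzsche, H. Grauert, *From Holomorphic Functions to Complex Manifolds* (2002), Ch. I §8,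
  Thm. 8.5 and Cor. 8.6. [FritzscheGrauert2002]
-/

noncomputable section

open scoped Manifold ContDiff Topology
open CategoryTheory AlgebraicGeometry MonoidalCategory Set Function
open Literature.AlgebraicGeometry.Motives (AlgPoints ComplexPoints SchemeOver)

namespace Literature.NumberTheory.Transcendental

/-! ### A holomorphic homeomorphism of equidimensional complex manifolds is a biholomorphism -/

section Inverse

variable {E₁ : Type*} [NormedAddCommGroup E₁] [NormedSpace ℂ E₁] [FiniteDimensional ℂ E₁]
  {H₁ : Type*} [TopologicalSpace H₁] {I₁ : ModelWithCorners ℂ E₁ H₁} [I₁.Boundaryless]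
  {N : Type*} [TopologicalSpace N] [ChartedSpace H₁ N] [IsManifold I₁ 1 N]
  {E₂ : Type*} [NormedAddCommGroup E₂] [NormedSpace ℂ E₂] [FiniteDimensional ℂ E₂]
  {H₂ : Type*} [TopologicalSpace H₂] {I₂ : ModelWithCorners ℂ E₂ H₂} [I₂.Boundaryless]
  {P : Type*} [TopologicalSpace P] [ChartedSpace H₂ P] [IsManifold I₂ 1 P]

/-- **A holomorphic homeomorphism between complex manifolds of the same dimension has holomorphic
inverse** (Clements–Osgood, Fritzsche–Grauert Ch. I §8 Thm. 8.5 / Cor. 8.6: an injective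
holomorphic map between equidimensional domains has everywhere invertible Jacobian, so its inverse
is holomorphic). In charts at `h⁻¹ p` and `p` the map `h` is injective and complex-differentiable on
an open set, hence has invertible differential (tree
`Literature.Analysis.Complex.SCV.bijective_fderiv_of_injOn`), and the chart expression of `h⁻¹`,
a continuous local inverse, is differentiable (`HasFDerivAt.of_local_left_inverse`).
[cite: FritzscheGrauert2002, Ch. I §8 Thm. 8.5 and Cor. 8.6] -/
theorem mdifferentiable_symm_of_mdifferentiable
    (hdim : Module.finrank ℂ E₁ = Module.finrank ℂ E₂) (h : N ≃ₜ P)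
    (hh : MDifferentiable I₁ I₂ h) : MDifferentiable I₂ I₁ h.symm := by
  intro p
  haveI : CompleteSpace E₁ := FiniteDimensional.complete ℂ E₁
  haveI : CompleteSpace E₂ := FiniteDimensional.complete ℂ E₂
  -- charts at `q = h⁻¹ p` and at `p`
  obtain ⟨q, hq⟩ : ∃ q : N, q = h.symm p := ⟨_, rfl⟩
  have hqp : h q = p := by rw [hq, h.apply_symm_apply]
  obtain ⟨c₁, hc₁⟩ : ∃ c : PartialEquiv N E₁, c = extChartAt I₁ q := ⟨_, rfl⟩
  obtain ⟨c₂, hc₂⟩ : ∃ c : PartialEquiv P E₂, c = extChartAt I₂ p := ⟨_, rfl⟩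
  -- the chart expression `F` of `h`, on the open set `U`
  obtain ⟨F, hF⟩ : ∃ F : E₁ → E₂, F = c₂ ∘ h ∘ c₁.symm := ⟨_, rfl⟩
  obtain ⟨U, hU⟩ : ∃ U : Set E₁, U = c₁.target ∩ c₁.symm ⁻¹' (h ⁻¹' c₂.source) := ⟨_, rfl⟩
  have hUo : IsOpen U := by
    rw [hU, hc₁, hc₂]
    exact (continuousOn_extChartAt_symm q).isOpen_inter_preimage (isOpen_extChartAt_target q)
      ((isOpen_extChartAt_source p).preimage h.continuous)
  have he₀U : c₁ q ∈ U := by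
    rw [hU]
    refine ⟨by rw [hc₁]; exact mem_extChartAt_target q, ?_⟩
    show h (c₁.symm (c₁ q)) ∈ c₂.source
    rw [hc₁, extChartAt_to_inv, hqp, hc₂]
    exact mem_extChartAt_source p
  have hFd : DifferentiableOn ℂ F U := by
    intro e he
    rw [hU] at he
    have hy : c₁.symm e ∈ (chartAt H₁ q).source := by
      rw [← extChartAt_source I₁, ← hc₁]
      exact c₁.map_target he.1
    have hhy : h (c₁.symm e) ∈ (chartAt H₂ p).source := by
      rw [← extChartAt_source I₂, ← hc₂]
      exact he.2
    have key := ((mdifferentiableAt_iff_of_mem_source hy hhy).1 (hh _)).2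
    rw [I₁.range_eq_univ, differentiableWithinAt_univ, ← hc₁, ← hc₂, c₁.right_inv he.1] at key
    rw [hF]
    exact key.differentiableWithinAt
  have hFi : InjOn F U := by
    intro e he e' he' hFe
    rw [hU] at he he'
    rw [hF] at hFe
    have h1 : h (c₁.symm e) = h (c₁.symm e') := c₂.injOn he.2 he'.2 hFe
    have h2 : c₁.symm e = c₁.symm e' := h.injective h1
    rw [← c₁.right_inv he.1, ← c₁.right_inv he'.1, h2]
  -- Clements–Osgood: the differential of `F` at `c₁ q` is invertible
  have hbij := Literature.Analysis.Complex.SCV.bijective_fderiv_of_injOn hdim hFd hUo hFi he₀U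
  obtain ⟨L, hL⟩ : ∃ L : E₁ ≃L[ℂ] E₂, (L : E₁ →L[ℂ] E₂) = fderiv ℂ F (c₁ q) :=
    ⟨ContinuousLinearEquiv.ofBijective (fderiv ℂ F (c₁ q)) (LinearMap.ker_eq_bot.2 hbij.1)
      (LinearMap.range_eq_top.2 hbij.2), ContinuousLinearEquiv.coe_ofBijective _ _ _⟩
  have hFat : HasFDerivAt F (L : E₁ →L[ℂ] E₂) (c₁ q) := by
    rw [hL]
    exact (hFd.differentiableAt (hUo.mem_nhds he₀U)).hasFDerivAt
  -- the chart expression `G` of `h⁻¹` is a continuous local inverse of `F`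
  obtain ⟨G, hG⟩ : ∃ G : E₂ → E₁, G = c₁ ∘ h.symm ∘ c₂.symm := ⟨_, rfl⟩
  have hG₀ : G (c₂ p) = c₁ q := by
    rw [hG, Function.comp_apply, Function.comp_apply, hc₂, extChartAt_to_inv, ← hq]
  have hGc : ContinuousAt G (c₂ p) := by
    rw [hG, hc₁, hc₂]
    refine ContinuousAt.comp ?_ (h.symm.continuous.continuousAt.comp (continuousAt_extChartAt_symm p))
    rw [Function.comp_apply, extChartAt_to_inv, ← hq]
    exact continuousAt_extChartAt q
  have hFG : ∀ᶠ z in 𝓝 (c₂ p), F (G z) = z := by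
    have h1 : ∀ᶠ z in 𝓝 (c₂ p), z ∈ c₂.target := by
      rw [hc₂]
      exact extChartAt_target_mem_nhds p
    have h2 : ∀ᶠ z in 𝓝 (c₂ p), h.symm (c₂.symm z) ∈ c₁.source := by
      have hc : ContinuousAt (fun z ↦ h.symm (c₂.symm z)) (c₂ p) := by
        rw [hc₂]
        exact h.symm.continuous.continuousAt.comp (continuousAt_extChartAt_symm p)
      refine hc.preimage_mem_nhds ?_
      rw [hc₂, extChartAt_to_inv, ← hq, hc₁]
      exact extChartAt_source_mem_nhds q
    filter_upwards [h1, h2] with z hz hz'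
    rw [hF, hG]
    show c₂ (h (c₁.symm (c₁ (h.symm (c₂.symm z))))) = z
    rw [c₁.left_inv hz', h.apply_symm_apply, c₂.right_inv hz]
  have hGd : HasFDerivAt G (L.symm : E₂ →L[ℂ] E₁) (c₂ p) :=
    HasFDerivAt.of_local_left_inverse hGc (hG₀ ▸ hFat) hFG
  -- conclusion
  rw [mdifferentiableAt_iff]
  refine ⟨h.symm.continuous.continuousAt, ?_⟩
  rw [I₂.range_eq_univ, differentiableWithinAt_univ]
  have hw : writtenInExtChartAt I₂ I₁ p h.symm = G := by
    rw [hG, hc₁, hc₂, hq]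
    rfl
  rw [hw, ← hc₂]
  exact hGd.differentiableAt

end Inverse

/-! ### Products of analytifications -/

section Instances

variable {k : Type} [Field k] {X Y : SchemeOver k}

/-- `X ×ₖ Y → Spec k` is locally of finite type when `X` and `Y` are (Hartshorne II Ex. 3.13 (c),
(d)). [folklore] -/
private theorem locallyOfFiniteType_tensorObj_hom [LocallyOfFiniteType X.hom]
    [LocallyOfFiniteType Y.hom] :
    LocallyOfFiniteType (X ⊗ Y).hom :=
  inferInstanceAs (LocallyOfFiniteType (Limits.pullback.fst X.hom Y.hom ≫ X.hom))

/-- `X ×ₖ Y → Spec k` is separated when `X` and `Y` are (Hartshorne II Cor. 4.6). [folklore] -/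
private theorem isSeparated_tensorObj_hom [IsSeparated X.hom] [IsSeparated Y.hom] :
    IsSeparated (X ⊗ Y).hom :=
  inferInstanceAs (IsSeparated (Limits.pullback.fst X.hom Y.hom ≫ X.hom))

end Instances

section Prod

variable {k : Type} [Field k] [Algebra k ℂ] {X Y : SchemeOver k} {n m : ℕ}
  {E : Type*} [NormedAddCommGroup E] [NormedSpace ℂ E] [FiniteDimensional ℂ E]
  {M : Type*} [TopologicalSpace M] [ChartedSpace E M] [IsManifold 𝓘(ℂ, E) ω M]
  {E' : Type*} [NormedAddCommGroup E'] [NormedSpace ℂ E'] [FiniteDimensional ℂ E']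
  {M' : Type*} [TopologicalSpace M'] [ChartedSpace E' M'] [IsManifold 𝓘(ℂ, E') ω M']
  {φ : M → ComplexPoints X} {ψ : M' → ComplexPoints Y}
  [LocallyOfFiniteType X.hom] [SmoothOfRelativeDimension n X.hom]
  [LocallyOfFiniteType Y.hom] [SmoothOfRelativeDimension m Y.hom]

/-- **`(X ×ₖ Y)^an ≅ X^an × Y^an` as complex manifolds** (Serre, GAGA §2 n°5 p. 9: «Si `X` et `Y`
sont deux variétés algébriques, on a `(X × Y)^h = X^h × Y^h`»; SGA 1 XII §1). Let `φ : M → X(ℂ)`, `ψ : M' → Y(ℂ)` be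
analytifications of the smooth `k`-schemes `X`, `Y` (locally of finite type) carrying holomorphic
atlases, and let `χ : N → (X ×ₖ Y)(ℂ)` be ANY analytification of the product with a holomorphic
atlas. Then there is a homeomorphism `Θ : M × M' ≃ₜ N`, holomorphic in both directions for the
product complex structure, over `(X ×ₖ Y)(ℂ) = X(ℂ) × Y(ℂ)`: `χ (Θ p) = (φ p.1, ψ p.2)` (pairs read
through `AlgPoints.prodEquiv`). Proof: `Θ⁻¹ = (φ⁻¹ ∘ pr₁(ℂ) ∘ χ, ψ⁻¹ ∘ pr₂(ℂ) ∘ χ)` is holomorphic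
by functoriality of the analytification and bijective; a holomorphic homeomorphism of
equidimensional manifolds is biholomorphic (`mdifferentiable_symm_of_mdifferentiable`).
[cite: SerreGAGA1956, §2 n°5 p. 9] [cite: SGA1, Exp. XII §1] -/
theorem exists_homeomorph_prod
    {F : Type*} [NormedAddCommGroup F] [NormedSpace ℂ F] [FiniteDimensional ℂ F]
    {N : Type*} [TopologicalSpace N] [ChartedSpace F N] [IsManifold 𝓘(ℂ, F) ω N]
    {χ : N → ComplexPoints (X ⊗ Y)}
    (hφ : IsAnalytification E X n φ) (hψ : IsAnalytification E' Y m ψ)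
    (hχ : IsAnalytification F (X ⊗ Y) (n + m) χ) :
    ∃ Θ : M × M' ≃ₜ N,
      MDifferentiable (𝓘(ℂ, E).prod 𝓘(ℂ, E')) 𝓘(ℂ, F) Θ ∧
      MDifferentiable 𝓘(ℂ, F) (𝓘(ℂ, E).prod 𝓘(ℂ, E')) Θ.symm ∧
      ∀ p : M × M', χ (Θ p) = AlgPoints.prodEquiv.symm (φ p.1, ψ p.2) := by
  classical
  haveI : LocallyOfFiniteType (X ⊗ Y).hom := locallyOfFiniteType_tensorObj_hom
  haveI : SmoothOfRelativeDimension (n + m) (X ⊗ Y).hom :=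
    Literature.AlgebraicGeometry.Motives.smoothOfRelativeDimension_tensor n m X Y
  haveI : IsManifold 𝓘(ℂ, F) 1 N := inferInstance
  haveI : IsManifold (𝓘(ℂ, E).prod 𝓘(ℂ, E')) 1 (M × M') := inferInstance
  -- `(X ×ₖ Y)(ℂ) ≃ₜ X(ℂ) × Y(ℂ)`
  have hpe : IsHomeomorph
      (AlgPoints.prodEquiv : AlgPoints (X ⊗ Y) ℂ ≃ AlgPoints X ℂ × AlgPoints Y ℂ) :=
    AlgPoints.isHomeomorph_prodEquiv_holds
  -- the candidate inverse `Ξ = (φ⁻¹ × ψ⁻¹) ∘ prodEquiv ∘ χ : N ≃ₜ M × M'`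
  obtain ⟨Ξ, hΞ⟩ : ∃ Ξ : N ≃ₜ M × M', Ξ = hχ.homeomorph.trans
      ((hpe.homeomorph _).trans (hφ.homeomorph.symm.prodCongr hψ.homeomorph.symm)) := ⟨_, rfl⟩
  have hΞ₁ : ∀ z, (Ξ z).1 =
      hφ.homeomorph.symm (AlgPoints.map (CartesianMonoidalCategory.fst X Y) (χ z)) := fun z ↦ by
    rw [hΞ]; rfl
  have hΞ₂ : ∀ z, (Ξ z).2 =
      hψ.homeomorph.symm (AlgPoints.map (CartesianMonoidalCategory.snd X Y) (χ z)) := fun z ↦ by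
    rw [hΞ]; rfl
  -- `Ξ` is holomorphic: its components are induced by the projections (functoriality)
  have h₁ : MDifferentiable 𝓘(ℂ, F) 𝓘(ℂ, E) (fun z ↦ (Ξ z).1) := by
    refine IsAnalytification.mdifferentiable_comp_map_holds hχ hφ
      (CartesianMonoidalCategory.fst X Y) _ (funext fun z ↦ ?_)
    simp only [Function.comp_apply, hΞ₁]
    exact hφ.homeomorph.apply_symm_apply _
  have h₂ : MDifferentiable 𝓘(ℂ, F) 𝓘(ℂ, E') (fun z ↦ (Ξ z).2) := by
    refine IsAnalytification.mdifferentiable_comp_map_holds hχ hψ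
      (CartesianMonoidalCategory.snd X Y) _ (funext fun z ↦ ?_)
    simp only [Function.comp_apply, hΞ₂]
    exact hψ.homeomorph.apply_symm_apply _
  have hΞd : MDifferentiable 𝓘(ℂ, F) (𝓘(ℂ, E).prod 𝓘(ℂ, E')) Ξ := by
    have := h₁.prodMk h₂
    exact this
  -- hence so is `Ξ⁻¹` (equal dimensions)
  have hdim : Module.finrank ℂ F = Module.finrank ℂ (E × E') := by
    rw [Module.finrank_prod, hχ.finrank_eq, hφ.finrank_eq, hψ.finrank_eq]
  have hΞs : MDifferentiable (𝓘(ℂ, E).prod 𝓘(ℂ, E')) 𝓘(ℂ, F) Ξ.symm :=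
    mdifferentiable_symm_of_mdifferentiable hdim Ξ hΞd
  refine ⟨Ξ.symm, hΞs, by simpa only [Homeomorph.symm_symm] using hΞd, fun p ↦ ?_⟩
  -- `χ ∘ Ξ⁻¹ = φ × ψ`
  obtain ⟨z, rfl⟩ : ∃ z, p = Ξ z := ⟨Ξ.symm p, (Ξ.apply_symm_apply p).symm⟩
  rw [Ξ.symm_apply_apply]
  apply AlgPoints.prodEquiv.injective
  rw [Equiv.apply_symm_apply, Prod.ext_iff]
  refine ⟨?_, ?_⟩
  · rw [hΞ₁]
    exact (hφ.homeomorph.apply_symm_apply _).symm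
  · rw [hΞ₂]
    exact (hψ.homeomorph.apply_symm_apply _).symm

/-- **The product of two analytifications is an analytification of the product** (Serre, GAGA §2
n°5 p. 9; SGA 1 XII §1): for `X`, `Y` smooth, separated and locally of finite type over `k ⊆ ℂ`
with analytifications `φ : M → X(ℂ)`, `ψ : M' → Y(ℂ)` carrying holomorphic atlases, the map
`p ↦ (φ p.1, ψ p.2) : M × M' → (X ×ₖ Y)(ℂ)` (through `AlgPoints.prodEquiv`) is an analytification
of `X ×ₖ Y` for the product charted space (model `E × E'`): it is a homeomorphism
(`AlgPoints.isHomeomorph_prodEquiv_holds`) and regular functions on affine opens of `X ×ₖ Y` pull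
back to holomorphic functions, because they do so on some analytification `N` of `X ×ₖ Y`
(`exists_isAnalytification_holds`) and `M × M' ≃ N` biholomorphically over `(X ×ₖ Y)(ℂ)`
(`exists_homeomorph_prod`). [cite: SerreGAGA1956, §2 n°5 p. 9] [cite: SGA1, Exp. XII §1] -/
theorem IsAnalytification.prod [IsSeparated X.hom] [IsSeparated Y.hom]
    (hφ : IsAnalytification E X n φ) (hψ : IsAnalytification E' Y m ψ) :
    @IsAnalytification (E × E') _ _ _ (M × M') _ (prodChartedSpace E M E' M') k _ _ (X ⊗ Y)
      (n + m) (fun p ↦ AlgPoints.prodEquiv.symm (φ p.1, ψ p.2)) := by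
  classical
  haveI : LocallyOfFiniteType (X ⊗ Y).hom := locallyOfFiniteType_tensorObj_hom
  haveI : SmoothOfRelativeDimension (n + m) (X ⊗ Y).hom :=
    Literature.AlgebraicGeometry.Motives.smoothOfRelativeDimension_tensor n m X Y
  haveI : IsSeparated (X ⊗ Y).hom := isSeparated_tensorObj_hom
  obtain ⟨N, _, _, _, _, χ, hχ⟩ := exists_isAnalytification_holds (X ⊗ Y) (n + m)
  obtain ⟨Θ, hΘ, -, hχΘ⟩ := exists_homeomorph_prod hφ hψ hχ
  have hfun : (fun p : M × M' ↦ AlgPoints.prodEquiv.symm (φ p.1, ψ p.2)) = χ ∘ Θ :=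
    funext fun p ↦ (hχΘ p).symm
  refine @IsAnalytification.mk (E × E') _ _ _ (M × M') _ (prodChartedSpace E M E' M') k _ _
    (X ⊗ Y) (n + m) _ ?_ ?_ ?_
  · rw [hfun]
    exact (Θ.trans hχ.homeomorph).isHomeomorph
  · rw [Module.finrank_prod, hφ.finrank_eq, hψ.finrank_eq]
  · intro U s
    have hN := hχ.mdifferentiableOn_evalOrZero U s
    have hc : MDifferentiableOn (𝓘(ℂ, E).prod 𝓘(ℂ, E')) 𝓘(ℂ, ℂ)
        ((fun z ↦ AlgPoints.evalOrZero (↑U : (X ⊗ Y).left.Opens) s (χ z)) ∘ Θ)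
        (Θ ⁻¹' (χ ⁻¹' {P | P.pt ∈ (↑U : (X ⊗ Y).left.Opens)})) :=
      hN.comp hΘ.mdifferentiableOn (fun p hp ↦ hp)
    have hfun' : (fun p : M × M' ↦ AlgPoints.evalOrZero (↑U : (X ⊗ Y).left.Opens) s
        (AlgPoints.prodEquiv.symm (φ p.1, ψ p.2))) =
        (fun z ↦ AlgPoints.evalOrZero (↑U : (X ⊗ Y).left.Opens) s (χ z)) ∘ Θ :=
      funext fun p ↦ by simp only [Function.comp_apply, hχΘ]
    have hset : (fun p : M × M' ↦ AlgPoints.prodEquiv.symm (φ p.1, ψ p.2)) ⁻¹'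
        {P | P.pt ∈ (↑U : (X ⊗ Y).left.Opens)} =
        Θ ⁻¹' (χ ⁻¹' {P | P.pt ∈ (↑U : (X ⊗ Y).left.Opens)}) := by
      ext p
      simp only [Set.mem_preimage, Set.mem_setOf_eq, hχΘ]
    rw [hfun', hset, modelWithCornersSelf_prod]
    exact hc

/-! ### Functoriality into and out of products -/

variable {Z : SchemeOver k} {e : ℕ} [LocallyOfFiniteType Z.hom] [SmoothOfRelativeDimension e Z.hom]
  {E'' : Type*} [NormedAddCommGroup E''] [NormedSpace ℂ E''] [FiniteDimensional ℂ E'']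
  {M'' : Type*} [TopologicalSpace M''] [ChartedSpace E'' M''] [IsManifold 𝓘(ℂ, E'') ω M'']
  {ζ : M'' → ComplexPoints Z}

/-- **Morphisms out of a product are holomorphic on the product manifold** (Serre, GAGA §2 n°5
p. 9, fonctorialité + produits): for `g : X ×ₖ Y ⟶ Z` (e.g. the group law `A ×ₖ A ⟶ A` of an
abelian variety) and analytifications `φ`, `ψ`, `ζ` with holomorphic atlases (`X`, `Y` smooth,
separated, locally of finite type; `Z` smooth, locally of finite type), the map `h : M × M' → M''`
induced on complex points (`ζ (h p) = g(ℂ)(φ p.1, ψ p.2)`) is holomorphic for Mathlib's product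
complex structure `𝓘(ℂ, E).prod 𝓘(ℂ, E')`. Proof: through a biholomorphism `M × M' ≃ N` with an
analytification `N` of `X ×ₖ Y` (`exists_homeomorph_prod`) this is functoriality of the
analytification (`IsAnalytification.mdifferentiable_comp_map_holds`).
[cite: SerreGAGA1956, §2 n°5 p. 9] -/
theorem mdifferentiable_of_comp_prod [IsSeparated X.hom] [IsSeparated Y.hom]
    (hφ : IsAnalytification E X n φ) (hψ : IsAnalytification E' Y m ψ)
    (hζ : IsAnalytification E'' Z e ζ) (g : X ⊗ Y ⟶ Z) (h : M × M' → M'')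
    (hh : ∀ p, ζ (h p) = AlgPoints.map g (AlgPoints.prodEquiv.symm (φ p.1, ψ p.2))) :
    MDifferentiable (𝓘(ℂ, E).prod 𝓘(ℂ, E')) 𝓘(ℂ, E'') h := by
  classical
  haveI : LocallyOfFiniteType (X ⊗ Y).hom := locallyOfFiniteType_tensorObj_hom
  haveI : SmoothOfRelativeDimension (n + m) (X ⊗ Y).hom :=
    Literature.AlgebraicGeometry.Motives.smoothOfRelativeDimension_tensor n m X Y
  haveI : IsSeparated (X ⊗ Y).hom := isSeparated_tensorObj_hom
  obtain ⟨N, _, _, _, _, χ, hχ⟩ := exists_isAnalytification_holds (X ⊗ Y) (n + m)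
  obtain ⟨Θ, hΘ, -, hχΘ⟩ := exists_homeomorph_prod hφ hψ hχ
  have hN : MDifferentiable 𝓘(ℂ, Fin (n + m) → ℂ) 𝓘(ℂ, E'') (h ∘ Θ.symm) := by
    refine IsAnalytification.mdifferentiable_comp_map_holds hχ hζ g _ (funext fun z ↦ ?_)
    simp only [Function.comp_apply, hh]
    rw [← hχΘ (Θ.symm z), Θ.apply_symm_apply]
  have : h = (h ∘ Θ.symm) ∘ Θ := by
    funext p
    simp only [Function.comp_apply, Θ.symm_apply_apply]
  rw [this]
  exact hN.comp hΘ

/-- **Morphisms into a product are holomorphic** (Serre, GAGA §2 n°5 p. 9): for `g : Z ⟶ X ×ₖ Y`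
and analytifications `φ`, `ψ`, `ζ` with holomorphic atlases, the map `h : M'' → M × M'` induced on
complex points (`(φ (h w).1, ψ (h w).2) = g(ℂ)(ζ w)`) is holomorphic into the product manifold:
its two components are induced by `g ≫ pr₁`, `g ≫ pr₂` (functoriality,
`IsAnalytification.mdifferentiable_comp_map_holds`). [cite: SerreGAGA1956, §2 n°5 p. 9] -/
theorem mdifferentiable_prodMk_of_comp
    (hφ : IsAnalytification E X n φ) (hψ : IsAnalytification E' Y m ψ)
    (hζ : IsAnalytification E'' Z e ζ) (g : Z ⟶ X ⊗ Y) (h : M'' → M × M')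
    (hh : ∀ w, AlgPoints.prodEquiv.symm (φ (h w).1, ψ (h w).2) = AlgPoints.map g (ζ w)) :
    MDifferentiable 𝓘(ℂ, E'') (𝓘(ℂ, E).prod 𝓘(ℂ, E')) h := by
  have hh' : ∀ w, (φ (h w).1, ψ (h w).2) = AlgPoints.prodEquiv (AlgPoints.map g (ζ w)) :=
    fun w ↦ by rw [← hh w, Equiv.apply_symm_apply]
  have h₁ : MDifferentiable 𝓘(ℂ, E'') 𝓘(ℂ, E) (fun w ↦ (h w).1) := by
    refine IsAnalytification.mdifferentiable_comp_map_holds hζ hφ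
      (g ≫ CartesianMonoidalCategory.fst X Y) _ (funext fun w ↦ ?_)
    simp only [Function.comp_apply, AlgPoints.map_comp_apply]
    rw [← AlgPoints.prodEquiv_apply_fst, ← hh' w]
  have h₂ : MDifferentiable 𝓘(ℂ, E'') 𝓘(ℂ, E') (fun w ↦ (h w).2) := by
    refine IsAnalytification.mdifferentiable_comp_map_holds hζ hψ
      (g ≫ CartesianMonoidalCategory.snd X Y) _ (funext fun w ↦ ?_)
    simp only [Function.comp_apply, AlgPoints.map_comp_apply]
    rw [← AlgPoints.prodEquiv_apply_snd, ← hh' w]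
  exact h₁.prodMk h₂

end Prod

end Literature.NumberTheory.Transcendental
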